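import Literature.Probability.Percolation.ArmSeparationSpoke
import Literature.Probability.Percolation.ArmSeparationLandingGlue
import Literature.Probability.Percolation.ArmSeparationIntSurgery
import HarnessLib

/-!
# The landing move: a tiny-fenced inner tip is carried to the landing free space

Topic: Probability / Percolation; family `crit-perc`. A brick of the discharge of
`Literature.Probability.Percolation.Nolin2008_twoArm_separation` (Nolin 2008, Thm. 11
[arXiv 0711.4948: Thm. 10], `j = 2`, `σ = BW`; `ArmSeparation.lean`), landing step of the internal
extremities (Nolin 2008, Prop. 12 (iii)–(i) [arXiv Prop. 11]). One colour at a time, in the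
normalised picture (open arm, landing on the right side of `∂Λ_n`): an arm of `χ` attached to an
outer free space at `uo` (`zo ∈ sepLanding N`) whose inner extremity is a fenced tip of the frame
`i` (`IntFencedArm`, tip row in the window `[T₀, T₀ + w)`), together with the corridor events —
the beacon about the tip, the spoke, an arc of the thin ring of radius `r` all of whose tubes are
crossed (containing a tube met by the spoke and a run of pieces of the side `x₀ = r` across the
target rows), the approach tube and the thinned target free space at the landing row
`tgtRow n b` — lands: `χ ∈ sepOpenArm n N`. This is `arm_to_entry` (`ArmSeparationSpoke.lean`)
followed by `landing_glue` (`ArmSeparationLandingGlue.lean`), with the bookkeeping that all the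
pieces lie in the arm region `sepJoinRegion n N zo (n, tgtRow n b)`.

* `norm_mem_of_mem_spokeBox`, `norm_mem_of_mem_tipBox'` — the spoke and the tip box lie in the
  annulus `{n ≤ |v| ≤ N}`;
* `landing_move` — the move.

## References

* P. Nolin, *Near-critical percolation in two dimensions*, Electron. J. Probab. 13 (2008), §4.2
  Def. 6–8, §4.3 Prop. 12, §4.4 [arXiv 0711.4948: Def. 6–8, Prop. 11, Thm. 10]. [Nolin2008]
* H. Kesten, *Scaling relations for 2D-percolation*, Comm. Math. Phys. 109 (1987), Lemma 2. [Kesten1987]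
-/

noncomputable section

open Set

namespace Literature.Probability.Percolation

open LatticeModels HalfAnnulus Tube

/-- **The spoke lies in the annulus**: a site `u` of the spoke's box (tip's frame; `c'₀ = m - 2k + 1`,
`c'₁ = T₀ + 2k + w`, tip row `t ∈ [T₀, T₀ + w)` with `-m + R₀ ≤ t ≤ -R₀`, `R₀ ≥ 4k ≥ 4ε + …`) has
norm in `[m - 2k + 1 - L, m - 1]`. [folklore] -/
theorem norm_mem_of_mem_spokeBox {m k R₀ L ε : ℕ} {T₀ t : ℤ} {w : ℕ} (hwin : T₀ ≤ t ∧ t < T₀ + w)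
    (ht : -(m : ℤ) + R₀ ≤ t ∧ t ≤ -(R₀ : ℤ)) (hR : 2 * (k : ℤ) + w + ε ≤ R₀) (hk : 1 ≤ k) (hL : (L : ℤ) + 2 * k ≤ m)
    {u : Site 2} (hu : u ∈ (spokeTube m k T₀ w L ε).box) :
    (m : ℤ) - 2 * k + 1 - L ≤ triNorm u ∧ triNorm u ≤ (m : ℤ) - 1 := by
  rw [Tube.mem_box] at hu
  simp only [spokeTube, bcnCentre, site_mk_apply_zero, site_mk_apply_one] at hu
  push_cast at hu
  have hk4 : 4 * ((k / 4 : ℕ) : ℤ) ≤ k := by omega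
  exact ⟨le_triNorm_iff_lin.2 (Or.inl (by omega)), triNorm_le_iff_lin.2 (by omega)⟩

/-- **The tip box lies in the annulus**: norms in `[m - 5k, m - 1]` (`-m + k ≤ t`, `t + 4k ≤ 0`, `5k ≤ m`). [folklore] -/
theorem norm_mem_of_mem_tipBox' {m k : ℕ} {t : ℤ} (h1 : -(m : ℤ) + k ≤ t) (h2 : t + 4 * k ≤ 0) (h3 : 5 * k ≤ m)
    {u : Site 2} (hu : u ∈ tipBox m t k) : (m : ℤ) - 5 * k ≤ triNorm u ∧ triNorm u ≤ (m : ℤ) - 1 := by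
  have h := tipBox_subset h1 h2 h3 u hu
  rw [mem_tipBox] at hu
  exact ⟨le_triNorm_iff_lin.2 (Or.inl hu.1), by omega⟩

/-- **The landing move.** See the file header: outer free space through `uo`; fenced tip `Fo` of
the frame `i` in the window; beacon, spoke (`4ε ≤ k`, `2k ≤ L`), an arc of the thin ring
(`1 ≤ s ∣ r`, `2e ≤ r`) all crossed, containing a tube `Te` met by the spoke and the run
`V_{j₀}, …, V_{j₀+d}` across the rows `[tgtRow n b, tgtRow n b + n/64]`; approach tube and thinned
target free space crossed; and the size conditions keeping every piece inside the annulus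
`{n ≤ |v| ≤ N}` below the tip's protections. Then `χ ∈ sepOpenArm n N`. [cite: Nolin2008, §4.3 Prop. 12 and §4.4 (arXiv 0711.4948: Prop. 11, Thm. 10)] -/
theorem landing_move {m n N k₀ K R₀ : ℕ} {i : ℕ} (hi : i < 6) {χ : SiteConfig (Site 2)} {zo uo : Site 2}
    (hzo : zo ∈ sepLanding N)
    (hOut : OpenVCrossThrough (sepOuterFence N zo) (zo 1 - (N / 64 : ℕ)) (zo 1 + (N / 64 : ℕ)) χ uo)
    (Fo : IntFencedArm m ((frameIso i).symm '' (triAnnulusSet m N ∪ triOpenBall zo (N / 8))) k₀ K R₀ (frameConfig i χ))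
    (hb : Fo.b = (frameIso i).symm uo)
    {T₀ : ℤ} {w : ℕ} (hwk : 4 * w ≤ Fo.k) (hk : 4 ≤ Fo.k) (hwin : T₀ ≤ Fo.z 1 ∧ Fo.z 1 < T₀ + w)
    (hB : frameConfig i χ ∈ triFrameAt (bcnCentre m Fo.k T₀ w) (Fo.k / 2))
    {L ε : ℕ} (hε : 4 * ε ≤ Fo.k) (hL : 2 * Fo.k ≤ L) (hSp : χ ∈ spokeEvent i m Fo.k T₀ w L ε)
    {r e s a len : ℕ} (hs : 1 ≤ s) (hsr : s ∣ r) (hsr' : s ≤ r) (he : 2 * e ≤ r)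
    (harc : χ ∈ eventAll (arc (thinRing r e s) a len))
    {Te : Tube} (hTe : Te ∈ arc (thinRing r e s) a len) (hJ : SpokeMeets i (spokeTube m Fo.k T₀ w L ε) Te)
    {b : Bool} {j₀ d : ℕ} (hSL : ∀ T ∈ vchunks r (-(r : ℤ)) e s j₀ (d + 1), T ∈ arc (thinRing r e s) a len)
    (hlo : -(r : ℤ) + j₀ * s - e ≤ tgtRow n b) (hhi : tgtRow n b + (n / 64 : ℕ) ≤ -(r : ℤ) + (j₀ + d) * s - e)
    {W : ℕ} (hW : (n : ℤ) - (n / 8 : ℕ) + 1 + W = r + 2 * e) (hH : χ ∈ tgtH n (tgtRow n b) W)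
    (hV : χ ∈ tgtV n (tgtRow n b))
    (hn : 64 ≤ n) (hnr : (n : ℤ) + s + 2 * e ≤ r) (hrm : (r : ℤ) + 2 * e ≤ m) (hmN : 2 * m ≤ N)
    (hnL : (n : ℤ) + 2 * Fo.k + L ≤ m + 1) (hn5 : (n : ℤ) + 5 * Fo.k ≤ m) (hR : 4 * Fo.k ≤ R₀) :
    χ ∈ sepOpenArm n N := by
  have hmN' : 2 * (m : ℤ) ≤ N := by exact_mod_cast hmN
  have hR' : 4 * (Fo.k : ℤ) ≤ R₀ := by exact_mod_cast hR
  have hwk' : 4 * (w : ℤ) ≤ Fo.k := by exact_mod_cast hwk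
  have hε' : 4 * (ε : ℤ) ≤ Fo.k := by exact_mod_cast hε
  obtain ⟨hz0, hz1, hz2⟩ := Fo.z_isIntJ
  have hmid : -(m : ℤ) + R₀ ≤ Fo.z 1 ∧ Fo.z 1 ≤ -(R₀ : ℤ) := Fo.z_mid
  obtain ⟨hm1, hm2⟩ := hmid
  have ht := mk_tgtRow_mem_sepLanding (show 16 ≤ n by omega) b
  -- the arc as a nonempty chain with prescribed crossings
  obtain ⟨E, L', hEL⟩ := List.exists_cons_of_ne_nil (List.ne_nil_of_mem hTe)
  have harc' : ∀ T ∈ E :: L', χ ∈ T.event := fun T hT => harc T (hEL ▸ hT)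
  have hch : List.IsChain Crosses (E :: L') := hEL ▸ isChain_arc_thinRing hs hsr hsr' a len
  obtain ⟨X, Y, hXY⟩ := exists_crossings harc'
  have hTe' : Te ∈ E :: L' := hEL ▸ hTe
  have hring : ∀ T ∈ E :: L', T ∈ thinRing r e s := fun T hT => mem_of_mem_arc (hEL ▸ hT : T ∈ arc (thinRing r e s) a len)
  have hLreg : ∀ T ∈ E :: L', T.box ⊆ triAnnulusSet n N := fun T hT v hv => by
    have := triNorm_mem_of_mem_thinRing he (hring T hT) hv
    rw [mem_triAnnulusSet]; constructor <;> omega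
  -- the hook
  have hHA : haSet m ⊆ (frameIso i).symm '' (triAnnulusSet m N ∪ triOpenBall zo (N / 8)) :=
    haSet_subset_image_frame_symm hi (triAnnSet_subset_extRegion hmN zo)
  have P₁ := arm_to_entry hHA hi Fo hwk hk hwin hB hε hL hSp (hXY Te hTe') hJ
  rw [hb, RelIso.apply_symm_apply] at P₁
  -- everything lies in the arm region
  have hreg : frameIso i '' ((spokeTube m Fo.k T₀ w L ε).box ∪
      ((frameIso i).symm '' (triAnnulusSet m N ∪ triOpenBall zo (N / 8)) ∪ tipBox m (Fo.z 1) Fo.k)) ∪ Te.box ⊆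
      sepJoinRegion n N zo ![(n : ℤ), tgtRow n b] := by
    have hann : ∀ v : Site 2, (n : ℤ) ≤ triNorm v → triNorm v ≤ N → v ∈ sepJoinRegion n N zo ![(n : ℤ), tgtRow n b] :=
      fun v h1 h2 => Or.inl (Or.inl ⟨h1, h2⟩)
    rintro v (⟨u, hu, rfl⟩ | hv)
    · rcases hu with hu | ⟨u', hu', rfl⟩ | hu
      · have := norm_mem_of_mem_spokeBox (R₀ := R₀) hwin ⟨hm1, hm2⟩ (by omega) (by omega) (by omega) hu
        exact hann _ (by rw [triNorm_frameIso i hi]; omega) (by rw [triNorm_frameIso i hi]; omega)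
      · rw [RelIso.apply_symm_apply]
        rcases hu' with hu' | hu'
        · exact hann _ ((show (n : ℤ) ≤ m by omega).trans (mem_triAnnulusSet.1 hu').1) (mem_triAnnulusSet.1 hu').2
        · exact Or.inl (Or.inr hu')
      · have := norm_mem_of_mem_tipBox' (by omega) (by omega) (by omega) hu
        exact hann _ (by rw [triNorm_frameIso i hi]; omega) (by rw [triNorm_frameIso i hi]; omega)
    · have := hLreg Te hTe' hv
      rw [mem_triAnnulusSet] at this
      exact hann v this.1 this.2
  -- glue
  exact landing_glue hzo hOut ht hch hXY hLreg hreg hTe' P₁ (fun T hT => hEL ▸ hSL T hT) hlo hhi (by omega) hW hH hV hn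
    (by omega)

end Literature.Probability.Percolation
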